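/-
Copyright (c) 2026 the pub-hodgecm-mathlib formalisation cell (harness21).  Prover seat hodgecm-mathlib-K2E3-p34 (g2), Track B «K2-LIT» ∕ h413 = `stmt-HodgeConjecture-24833`,
line `K2_E3_EllipticInputs`, unit U4 «Keys», socket :182 `sig_K2E3KeysThmTwoContractingRamifiedCharOnePosDepth`, programme A_pos^{<}: brick (ii)^{<} «THE DEEP BIG CELL
OF A LOWER UNIPOTENT LANDS IN `P·w·(J_e ∩ N)` FOR THE TWO-DEPTH (CONCAVE-EXPONENT) LEVEL GROUP `J_e`» — the two-depth twin of ★ `K2E3LowerUnipotentBigCellIntegral`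
(K2E3-p37 (g0)) over ★ D174 `K2E3IwahoriTwoDepthFactorisation` (K2E3-p14 (g9)); default offer 2026-09-04T22:22:37Z under L4 LINE-LEAD K2E3-plan (g5).  REPORT-FIRST 2026-09-04.
-/
import Summits.HodgeConjecture.HodgeConjecture.Theorems.K2E3LowerUnipotentBigCellIntegral    -- ★ p861613 (K2E3-p37 g0): `exists_borel_mul_weylLongU_mul_upper` (`ū(x,z) = p·w·u(x∕z, 1∕z)`); brings ★ `exists_coe_eq_lower_of_mem_map`
import Summits.HodgeConjecture.HodgeConjecture.Theorems.K2E3IwahoriTwoDepthFactorisation    -- ★ D174 (K2E3-p14 g9): the letters `e`, `Jg`, `hJg`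
import HarnessLib

/-!
# K2 ∕ E3 «EllipticInputs», unit U4 «Keys» — (U4f-χ₁-ram-one-pos), programme A_pos^{<} brick (ii)^{<}: THE DEEP BIG CELL OF A LOWER UNIPOTENT OF `U(σ, Φ₃)(K)`
# FOR A TWO-DEPTH LEVEL GROUP «`|z| ≥ |ϖ|^{-2·e₀₁}` and `|z| ≥ |ϖ|^{-e₀₂}` ⟹ `ū(x, z) ∈ P · w · (J_e ∩ N)`»   [Casselman1995 Prop. 1.3.1; BruhatTits1972 (4.4.4), (6.4.9); Rogawski1990 §1.10]

Cell hodgecm-mathlib, Track B «K2-LIT», crux item H413 = stmt-HodgeConjecture-24833 (route `HCCMUnconditional`, no route verbs); target BY NAME the OPEN tier-0 leaf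
`…K2E3EllipticInputs.U4Keys.sig_K2E3KeysThmTwoContractingRamifiedCharOnePosDepth` (U4Keys :182), regime A_pos^{<} (cond(χ₁|_{F×}) < cond χ₁; p37 (g0) memo §9).  Author K2E3-p34 (g2).
`--supports stmt-HodgeConjecture-24833 --as helper`; THEOREMS ONLY (no `def` ∕ `instance` ∕ `notation` ∕ named fact ∕ `sorry`); MODEL level (`U(σ, Φ₃)(K)`, `Valued K ℤᵐ⁰`, an
isometric involution `σ`, a uniformiser `ϖ`), letters of ★ p861613 (`σ hJ hσ hvσ hvϖ`) and of ★ D174 (`e`, `Jg`, `hJg : ∀ k, k ∈ Jg ↔ ∀ i j, |k i j| ≤ |ϖ| ^ e i j`).  NOT THE PAYER of :182.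

THE POINT.  ★ p861613 factorises a lower unipotent `n̄ = ū(x, z)` (`z + σz + xσx = 0`, `z ≠ 0`) EXPLICITLY as `ū(x, z) = p · w · u(x∕z, 1∕z)`, `p ∈ B`, and concludes
`|z| ≥ 1 ⟹ u(x∕z, 1∕z) ∈ N ∩ K₀ ⊆ J_n` for the UNIFORM level `J_n` — because `N ∩ K₀ ≤ J_n`.  For the two-depth group `J_e` of A_pos^{<} (upper depths `e 0 1 = r ≥ 1`,
`e 0 2 = s ≥ 1`) this containment FAILS: `N ∩ J_e = {u(y, b) : |y| ≤ |ϖ|^r, |b| ≤ |ϖ|^s}`.  The right factor `u(x∕z, 1∕z)` has `|1∕z| = |z|⁻¹` and `|x∕z|² ≤ |z|∕|z|² = |z|⁻¹`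
(★ `v_mul_v_le_of_rel`: `|x|² ≤ |z|`), so it lies in `J_e` exactly on the DEEP big cell `|z| ≥ |ϖ|^{-2r}` and `|z| ≥ |ϖ|^{-s}` (= `|z| ≥ |ϖ|^{-2r}` under the concavity
`s ≤ 2r`).  There the depth-zero Branch-A torus witness transports as in the (c1)+(c2) assembly for `J_n` (★ `K2E3LowerUnipotentBigCellCM` ∕ ★ `K2E3BranchATorusWitnessLevelN`);
the UPPER SHELLS `1 ≤ |z| < |ϖ|^{-2r}` are NEW cells `P·w·u′·J_e` (`u′ ∈ N(𝒪) ∖ J_e`) of the two-depth cell family and need their own witnesses (census memo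
`K2/K2E3-p34/g2/CENSUS-Apos-lt-shells.md`) — not in this file.
* §1 `v_div_le_pow_of_le_v` (`|z| ≥ |ϖ|^{-2r} ⟹ |x∕z| ≤ |ϖ|^r`), `v_inv_le_pow_of_le_v` (`|z| ≥ |ϖ|^{-s} ⟹ |1∕z| ≤ |ϖ|^s`).
* §2 `mem_of_coe_eq_upper` (the test for `u(a, b)`), the SHARP cell `exists_borel_mul_weylLongU_mul_mem_of_v_div_le` ∕ `_of_v_apply_div_le` (`|x∕z| ≤ |ϖ|^{e 0 1}`,
  `|z| ≥ |ϖ|^{-e 0 2}` ⟹ `n̄ = p·w·u`, `p ∈ B`, `u ∈ Jg`) and the DEEP cell **`exists_borel_mul_weylLongU_mul_mem_of_le_v`** ∕ `_of_coe_eq` (`|n̄₂₀| ≥ |ϖ|^{-2·e 0 1}`,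
  `|n̄₂₀| ≥ |ϖ|^{-e 0 2}`; conclusion shape = ★ `exists_borel_mul_weylLongU_mul_mem_inf_pow` with `J_n ↦ Jg`).
HONEST LABEL: HC_CM is proved only modulo the 7 printed citations (2 remaining named inputs: hLiu418 = stmt-HodgeConjecture-24832, h413 = stmt-HodgeConjecture-24833)
until rung 0 closes; count-neutral — this file pays no socket and closes nothing; no printed citation is discharged.

## References
* [Casselman1995] W. Casselman, *Introduction to the theory of admissible representations of `p`-adic reductive groups* (1995), Prop. 1.3.1 (Bruhat decomposition), Prop. 1.4.4.
* [BruhatTits1972] F. Bruhat, J. Tits, *Groupes réductifs sur un corps local I*, Publ. Math. IHÉS 41 (1972), (4.4.3)–(4.4.4), (6.4.9) (concave functions, the groups `P_f`).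
* [Rogawski1990] J. D. Rogawski, *Automorphic Representations of Unitary Groups in Three Variables*, Ann. of Math. Stud. 123 (1990), §1.9–§1.10 pp. 8–9.
* [Serre1979] J.-P. Serre, *Local Fields*, GTM 67 (1979), Ch. II §1 (the ultrametric inequality).
-/

set_option autoImplicit false
-- the mandated namespace repeats the single-problem summit's segment (`HodgeConjecture.HodgeConjecture`)
set_option linter.dupNamespace false

noncomputable section

open Matrix Literature.NumberTheory.Automorphic Literature.NumberTheory.Automorphic.UnitaryGroup
open scoped Matrix MatrixGroups WithZero

namespace Summit.HodgeConjecture.HodgeConjecture.Cruxes.H413.K2E3LowerUnipotentDeepCellTwoDepth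

open Summit.HodgeConjecture.HodgeConjecture.Cruxes.H413

variable {K : Type*} [Field K] [Valued K ℤᵐ⁰]
  (σ : K →+* K) {ϖ : K} {J : Matrix (Fin 3) (Fin 3) K} (hJ : J = (StdForm.antidiagonal 3).over K)
  (hσ : ∀ a, σ (σ a) = a) (hvσ : ∀ a, Valued.v (σ a) = Valued.v a) (hvϖ : Valued.v ϖ = WithZero.exp (-1 : ℤ))
  (e : Fin 3 → Fin 3 → ℕ) (Jg : Subgroup ↥(unitaryGroupOfForm σ J))
  (hJg : ∀ k : ↥(unitaryGroupOfForm σ J), k ∈ Jg ↔ ∀ i j, Valued.v (((k : GL (Fin 3) K) : Matrix (Fin 3) (Fin 3) K) i j) ≤ Valued.v ϖ ^ e i j)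

/-! ## §1 Valuations on the deep big cell: `|x∕z| ≤ |ϖ|^r`, `|1∕z| ≤ |ϖ|^s` -/

include hvσ hvϖ in
/-- **`|z| ≥ |ϖ|^{-2r} ⟹ |x∕z| ≤ |ϖ|^r`** on `N̄` (`z + σz + xσx = 0` gives `|x|² ≤ |z|`, ★ `v_mul_v_le_of_rel`, so `|x∕z|² ≤ |z|⁻¹ ≤ |ϖ|^{2r}`).
[cite: Rogawski1990, §1.10 p. 9] [cite: Serre1979, Ch. II §1] -/
theorem v_div_le_pow_of_le_v {x z : K} (hrel : z + σ z + x * σ x = 0) {r : ℕ} (hz : (Valued.v ϖ ^ (2 * r))⁻¹ ≤ Valued.v z) :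
    Valued.v (x / z) ≤ Valued.v ϖ ^ r := by
  have hvϖ0 : Valued.v ϖ ≠ 0 := (Valuation.ne_zero_iff _).2 (CartanUnique.uniformizer_ne_zero hvϖ)
  have hpow : 0 < Valued.v ϖ ^ (2 * r) := pow_pos (zero_lt_iff.2 hvϖ0) _
  have hz0 : 0 < Valued.v z := lt_of_lt_of_le (inv_pos.2 hpow) hz
  have hxx : Valued.v x * Valued.v x ≤ Valued.v z := v_mul_v_le_of_rel σ hvσ hrel
  -- `|x∕z|² ≤ |z|⁻¹ ≤ |ϖ|^{2r} = (|ϖ|^r)²`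
  have hsq : Valued.v (x / z) ^ 2 ≤ (Valued.v ϖ ^ r) ^ 2 := by
    rw [map_div₀, div_pow, pow_two, pow_two, ← pow_mul, mul_comm r 2]
    calc Valued.v x * Valued.v x / (Valued.v z * Valued.v z) ≤ Valued.v z / (Valued.v z * Valued.v z) := by gcongr
      _ = (Valued.v z)⁻¹ := by rw [div_mul_eq_div_div, div_self hz0.ne', one_div]
      _ ≤ Valued.v ϖ ^ (2 * r) := inv_le_of_inv_le₀ hpow hz
  exact le_of_pow_le_pow_left₀ two_ne_zero zero_le hsq

include hvϖ in
/-- **`|z| ≥ |ϖ|^{-s} ⟹ |1∕z| ≤ |ϖ|^s`.** [cite: Serre1979, Ch. II §1] -/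
theorem v_inv_le_pow_of_le_v {z : K} {s : ℕ} (hz : (Valued.v ϖ ^ s)⁻¹ ≤ Valued.v z) : Valued.v z⁻¹ ≤ Valued.v ϖ ^ s := by
  have hvϖ0 : Valued.v ϖ ≠ 0 := (Valuation.ne_zero_iff _).2 (CartanUnique.uniformizer_ne_zero hvϖ)
  rw [map_inv₀]
  exact inv_le_of_inv_le₀ (pow_pos (zero_lt_iff.2 hvϖ0) _) hz

/-! ## §2 The deep big cell lands in `P · w · Jg` -/

include hvσ hJg in
/-- **The two-depth test for an upper unitriangular `u(a, b)`**: a unitary of matrix `!![1, a, b; 0, 1, -σ a; 0, 0, 1]` lies in `Jg` as soon as `|a| ≤ |ϖ|^{e 0 1}`, `|b| ≤ |ϖ|^{e 0 2}`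
(`e i i = 0`, anti-transpose symmetry `e 1 2 = e 0 1`). [cite: BruhatTits1972, (6.4.9)] [cite: Rogawski1990, §1.10 p. 9] -/
theorem mem_of_coe_eq_upper (he0 : ∀ i, e i i = 0) (hsym : ∀ i j, e (Fin.rev j) (Fin.rev i) = e i j) {u : ↥(unitaryGroupOfForm σ J)} {a b : K}
    (hu : ((u : GL (Fin 3) K) : Matrix (Fin 3) (Fin 3) K) = !![1, a, b; 0, 1, -σ a; 0, 0, 1])
    (ha : Valued.v a ≤ Valued.v ϖ ^ e 0 1) (hb : Valued.v b ≤ Valued.v ϖ ^ e 0 2) : u ∈ Jg := by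
  have h12 : e 1 2 = e 0 1 := (hsym 1 2).symm
  have hσa : Valued.v (-σ a) ≤ Valued.v ϖ ^ e 1 2 := by rw [Valuation.map_neg, hvσ, h12]; exact ha
  rw [hJg, hu]
  intro i j
  fin_cases i <;> fin_cases j
  all_goals simp only [Fin.zero_eta, Fin.mk_one, Fin.reduceFinMk, Fin.isValue, Matrix.of_apply, Matrix.cons_val', Matrix.cons_val_zero, Matrix.cons_val_one,
    Matrix.cons_val, Matrix.empty_val', Matrix.cons_val_fin_one, map_one, map_zero, zero_le, he0, pow_zero, le_refl]
  all_goals first | exact ha | exact hb | exact hσa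

include hJ hσ hvσ hvϖ hJg in
/-- **THE BIG CELL MEETS `P · w · Jg` EXACTLY WHERE `|x∕z| ≤ |ϖ|^{e 0 1}` AND `|z| ≥ |ϖ|^{-e 0 2}`** (sufficiency, on coordinates): for `n̄ ∈ U(σ, Φ₃)` of matrix `ū(x, z)`
(`z + σz + xσx = 0`) with `|x∕z| ≤ |ϖ|^{e 0 1}` and `|z| ≥ |ϖ|^{-e 0 2}`: `n̄ = p · w · u`, `p ∈ B`, `u = u(x∕z, 1∕z) ∈ Jg` (★ `exists_borel_mul_weylLongU_mul_upper` + `mem_of_coe_eq_upper`).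
(The factorisation `P·w·N ∋ n̄ = p·w·u` is unique, so these two inequalities are also NECESSARY for `n̄ ∈ P·w·Jg = P·w·(Jg ∩ N)`; the lower unipotents with `|z| ≥ 1` failing them —
the «upper shells» — are further cells of the two-depth cell family.) [cite: Casselman1995, Prop. 1.3.1] [cite: BruhatTits1972, (4.4.4), (6.4.9)] [cite: Rogawski1990, §1.10 p. 9] -/
theorem exists_borel_mul_weylLongU_mul_mem_of_v_div_le (he0 : ∀ i, e i i = 0) (hsym : ∀ i j, e (Fin.rev j) (Fin.rev i) = e i j)
    {nb : ↥(unitaryGroupOfForm σ J)} {x z : K}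
    (hnb : ((nb : GL (Fin 3) K) : Matrix (Fin 3) (Fin 3) K) = !![1, 0, 0; -σ x, 1, 0; z, x, 1]) (hrel : z + σ z + x * σ x = 0)
    (hxz : Valued.v (x / z) ≤ Valued.v ϖ ^ e 0 1) (hz' : (Valued.v ϖ ^ e 0 2)⁻¹ ≤ Valued.v z) :
    ∃ p ∈ borelU σ J, ∃ u ∈ Jg, nb = p * weylLongU σ hJ * u := by
  have hvϖ0 : Valued.v ϖ ≠ 0 := (Valuation.ne_zero_iff _).2 (CartanUnique.uniformizer_ne_zero hvϖ)
  have hz0 : z ≠ 0 := fun h => by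
    rw [h, map_zero] at hz'
    exact absurd hz' (not_le.2 (inv_pos.2 (pow_pos (zero_lt_iff.2 hvϖ0) _)))
  obtain ⟨p, u, hp, -, hu, heq⟩ := K2E3LowerUnipotentBigCellIntegral.exists_borel_mul_weylLongU_mul_upper σ hJ hσ hnb hrel hz0
  exact ⟨p, hp, u, mem_of_coe_eq_upper σ hvσ e Jg hJg he0 hsym hu hxz (v_inv_le_pow_of_le_v hvϖ hz'), heq⟩

include hJ hσ hvσ hvϖ hJg in
/-- **THE DEEP BIG CELL, on coordinates**: for `n̄` of matrix `ū(x, z)` (`z + σz + xσx = 0`) with `|z| ≥ |ϖ|^{-2·e 0 1}` and `|z| ≥ |ϖ|^{-e 0 2}`: `n̄ = p · w · u`, `p ∈ B`,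
`u ∈ Jg` (§1 `v_div_le_pow_of_le_v` feeds `exists_borel_mul_weylLongU_mul_mem_of_v_div_le`). [cite: Casselman1995, Prop. 1.3.1] [cite: BruhatTits1972, (4.4.4), (6.4.9)] -/
theorem exists_borel_mul_weylLongU_mul_mem_of_coe_eq (he0 : ∀ i, e i i = 0) (hsym : ∀ i j, e (Fin.rev j) (Fin.rev i) = e i j)
    {nb : ↥(unitaryGroupOfForm σ J)} {x z : K}
    (hnb : ((nb : GL (Fin 3) K) : Matrix (Fin 3) (Fin 3) K) = !![1, 0, 0; -σ x, 1, 0; z, x, 1]) (hrel : z + σ z + x * σ x = 0)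
    (hz : (Valued.v ϖ ^ (2 * e 0 1))⁻¹ ≤ Valued.v z) (hz' : (Valued.v ϖ ^ e 0 2)⁻¹ ≤ Valued.v z) :
    ∃ p ∈ borelU σ J, ∃ u ∈ Jg, nb = p * weylLongU σ hJ * u :=
  exists_borel_mul_weylLongU_mul_mem_of_v_div_le σ hJ hσ hvσ hvϖ e Jg hJg he0 hsym hnb hrel (v_div_le_pow_of_le_v σ hvσ hvϖ hrel hz) hz'

include hJ hσ hvσ hvϖ hJg in
/-- **THE BIG CELL MEETS `P · w · Jg` — membership form**: for `n̄ ∈ N̄ = N.map (conj w)` (shape ★ `exists_coe_eq_lower_of_mem_map`: `n̄ = ū(n̄₂₁, n̄₂₀)`) with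
`|n̄₂₁ ∕ n̄₂₀| ≤ |ϖ|^{e 0 1}` and `|n̄₂₀| ≥ |ϖ|^{-e 0 2}`: `n̄ = p · w · u`, `p ∈ B`, `u ∈ Jg`. [cite: Casselman1995, Prop. 1.3.1] [cite: BruhatTits1972, (4.4.4), (6.4.9)] -/
theorem exists_borel_mul_weylLongU_mul_mem_of_v_apply_div_le (he0 : ∀ i, e i i = 0) (hsym : ∀ i j, e (Fin.rev j) (Fin.rev i) = e i j)
    {nb : ↥(unitaryGroupOfForm σ J)} (hnb : nb ∈ ((borelTriple σ J hJ).N).map (MulAut.conj (weylLongU σ hJ)).toMonoidHom)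
    (hxz : Valued.v (((nb : GL (Fin 3) K) : Matrix (Fin 3) (Fin 3) K) 2 1 / ((nb : GL (Fin 3) K) : Matrix (Fin 3) (Fin 3) K) 2 0) ≤ Valued.v ϖ ^ e 0 1)
    (hz' : (Valued.v ϖ ^ e 0 2)⁻¹ ≤ Valued.v (((nb : GL (Fin 3) K) : Matrix (Fin 3) (Fin 3) K) 2 0)) :
    ∃ p ∈ borelU σ J, ∃ u ∈ Jg, nb = p * weylLongU σ hJ * u := by
  obtain ⟨x, z, hnbv, hrel⟩ := K2E3LowerUnipotentBorelIwahori.exists_coe_eq_lower_of_mem_map σ hJ hσ hnb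
  have h20 : ((nb : GL (Fin 3) K) : Matrix (Fin 3) (Fin 3) K) 2 0 = z := by rw [hnbv]; rfl
  have h21 : ((nb : GL (Fin 3) K) : Matrix (Fin 3) (Fin 3) K) 2 1 = x := by rw [hnbv]; rfl
  rw [h20, h21] at hxz
  rw [h20] at hz'
  exact exists_borel_mul_weylLongU_mul_mem_of_v_div_le σ hJ hσ hvσ hvϖ e Jg hJg he0 hsym hnbv hrel hxz hz'

include hJ hσ hvσ hvϖ hJg in
/-- **THE DEEP BIG CELL `|n̄₂₀| ≥ |ϖ|^{-2·e 0 1}`, `|n̄₂₀| ≥ |ϖ|^{-e 0 2}` OF A LOWER UNIPOTENT LANDS IN `P · w · Jg`** — for `n̄ ∈ N̄ = N.map (conj w)`: `n̄ = p · w · u`, `p ∈ B`,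
`u ∈ Jg`.  Conclusion shape = ★ `K2E3LowerUnipotentBigCellIntegral.exists_borel_mul_weylLongU_mul_mem_inf_pow` with `J_n ↦ Jg` (there `|n̄₂₀| ≥ 1` suffices because `N ∩ K₀ ≤ J_n`;
here the two upper depths of `Jg` cost the factors `|ϖ|^{-2r}`, `|ϖ|^{-s}`): on this cell the depth-zero Branch-A witness transports along `p` and `u` as in ★ p861573's `hwit`.
[cite: Casselman1995, Prop. 1.3.1] [cite: BruhatTits1972, (4.4.4), (6.4.9)] [cite: Rogawski1990, §1.10 p. 9] -/
theorem exists_borel_mul_weylLongU_mul_mem_of_le_v (he0 : ∀ i, e i i = 0) (hsym : ∀ i j, e (Fin.rev j) (Fin.rev i) = e i j)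
    {nb : ↥(unitaryGroupOfForm σ J)} (hnb : nb ∈ ((borelTriple σ J hJ).N).map (MulAut.conj (weylLongU σ hJ)).toMonoidHom)
    (hz : (Valued.v ϖ ^ (2 * e 0 1))⁻¹ ≤ Valued.v (((nb : GL (Fin 3) K) : Matrix (Fin 3) (Fin 3) K) 2 0))
    (hz' : (Valued.v ϖ ^ e 0 2)⁻¹ ≤ Valued.v (((nb : GL (Fin 3) K) : Matrix (Fin 3) (Fin 3) K) 2 0)) :
    ∃ p ∈ borelU σ J, ∃ u ∈ Jg, nb = p * weylLongU σ hJ * u := by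
  obtain ⟨x, z, hnbv, hrel⟩ := K2E3LowerUnipotentBorelIwahori.exists_coe_eq_lower_of_mem_map σ hJ hσ hnb
  have h20 : ((nb : GL (Fin 3) K) : Matrix (Fin 3) (Fin 3) K) 2 0 = z := by rw [hnbv]; rfl
  rw [h20] at hz hz'
  exact exists_borel_mul_weylLongU_mul_mem_of_coe_eq σ hJ hσ hvσ hvϖ e Jg hJg he0 hsym hnbv hrel hz hz'

end Summit.HodgeConjecture.HodgeConjecture.Cruxes.H413.K2E3LowerUnipotentDeepCellTwoDepth

end
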